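import Literature.AlgebraicGeometry.HodgeTheory.RealMultiplicationHodgeLieAlgebra
import HarnessLib

/-!
# `End_Hdg(H¹(B(ℂ); ℚ)) = End⁰(B)ᵒᵖ` for EVERY complex abelian variety (Riemann; Deligne–Milne Thm. 6.20), field-free; `Hom(A, B) = 0 ⟹ Hom_Hdg(H¹(B), H¹(A)) = 0`

Family `hodge`, layer `Literature/AlgebraicGeometry/HodgeTheory`. Research context: cell `pub-hodge-ring2`
(HONEST FRAMING: research route conditional on HC_CM; not a corollary; Q11.4-sentence-2 already refuted in
dim ≥ 3), Literature lane, programme R3 brick B′2 (`pub-hodge-ring2-lit-g40/PLAN-R3.md`): the bridge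
`RealMultiplicationHodgeLieAlgebra` (§1 `mem_endAlg_hodge_one_iff`, `endFieldAlgEquivEndAlg`) identifies the Hodge
endomorphisms of `H¹(B(ℂ); ℚ)` with `End⁰(B)` ONLY when `End⁰(B)` is a field (`hF : IsField B.endAlgebra`,
carrier `EndField B hF`). This file removes that restriction. UNCONDITIONAL (Riemann's theorem is the tree
theorem `deligneMilne1982_Thm_6_20_full_holds`; `hHD`, `hI` are the tree theorems
`exists_isReal_hodgeModel_holds`, `hodgePQ_independent_of_hodgeModel_holds`, kept as arguments as everywhere in
the Betti universe); no step towards a summit statement.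

PUBLISHED STATEMENT. Deligne–Milne, *Tannakian categories* (LNM 900), Thm. 6.20 (Riemann): the functor
`A ↦ H₁(A, ℚ)` from complex abelian varieties up to isogeny to polarizable `ℚ`-Hodge structures of type
`{(-1,0),(0,-1)}` is fully faithful — `Hom(A, B) ⊗ ℚ ≅ Hom_Hdg(H¹(B), H¹(A))`; Lange, *Abelian Varieties over
the Complex Numbers*, Prop. 1.1.8 / Thm. 2.4.x (the rational representation is faithful); Mumford §19.

MAIN RESULTS (all proved):
* `unop_bettiRep_mem_endAlg` — every `e ∈ End⁰(B)` acts on `H¹(B(ℂ); ℚ)` by a Hodge endomorphism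
  (`(bettiRep B e).unop ∈ End_Hdg`; pull-backs preserve the Hodge filtration, `BettiUniverse.pull_hodge`);
* `mem_endAlg_hodge_one_iff_exists_bettiRep` — **RIEMANN, field-free**: `a ∈ End_Hdg(H¹(B(ℂ); ℚ)) ↔
  ∃ e : End⁰(B), (bettiRep B e).unop = a`;
* `bettiRepOp` / `endAlgebraOpAlgEquivEndAlg : End⁰(B)ᵐᵒᵖ ≃ₐ[ℚ] End_Hdg(H¹(B(ℂ); ℚ))` (DATA; the
  representation is contravariant, `(f g)^* = g^* f^*`), and for COMMUTATIVE `End⁰(B)` — e.g. a product of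
  fields, the case of `A₁ × A₂` with `A₁`, `A₂` orthogonal real-multiplication varieties (R3) —
  `bettiRepOfComm` / `endAlgebraAlgEquivEndAlgOfComm : End⁰(B) ≃ₐ[ℚ] End_Hdg(H¹(B(ℂ); ℚ))`;
  `finrank_endAlg_hodge_one` (`dim_ℚ End_Hdg(H¹) = dim_ℚ End⁰(B)`);
* `hodgeHom_one_eq_zero_of_forall_hom_eq_zero` — **`Hom(A, B) = 0 ⟹` every `ℚ`-linear
  `H¹(B(ℂ); ℚ) → H¹(A(ℂ); ℚ)` preserving the Hodge filtrations is `0`** (the R3 input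
  «`Hom_Hdg(H¹(A₂), H¹(A₁)) = 0` for non-isogenous simple `A₁`, `A₂`»).

## References

* [DeligneMilne1982Tannakian] P. Deligne, J. S. Milne, *Tannakian Categories*, LNM 900 (1982), §6 Thm. 6.20
  (Riemann), p. 212. [cite: DeligneMilne1982Tannakian, §6 Thm. 6.20]
* [Deligne1982HodgeCycles] P. Deligne, *Hodge cycles on abelian varieties*, LNM 900 (1982), §4 p. 30
  (`End⁰(A)` acts on `H¹_B` by Hodge endomorphisms). [cite: Deligne1982HodgeCycles, §4 p. 30]
* [Lange2023AbelianVarietiesC] H. Lange, *Abelian Varieties over the Complex Numbers* (2023), Prop. 1.1.8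
  (the rational representation is injective) and Cor. 2.4.26. [cite: Lange2023AbelianVarietiesC, Prop. 1.1.8 and Cor. 2.4.26]
* [VoisinHodgeI2002] C. Voisin, *Hodge Theory and Complex Algebraic Geometry I*, §7.3.2 (morphisms of Hodge
  structures induced by holomorphic maps). [cite: VoisinHodgeI2002, §7.3.2]
-/

noncomputable section

open scoped TensorProduct
open CategoryTheory Module

namespace Literature.AlgebraicGeometry.HodgeTheory

open Literature.AlgebraicGeometry.Motives Literature.AlgebraicGeometry.ComplexMultiplication
open Literature.AlgebraicGeometry.Motives.HodgeStructure

section Riemann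

variable {A B : AbelianVariety ℂ}

/-! ### §1 `End⁰(B)` acts by Hodge endomorphisms -/

/-- **Every element of `End⁰(B)` acts on `H¹(B(ℂ); ℚ)` as a rational multiple of a pull-back**:
`e = M⁻¹ · (1 ⊗ F)` in `End⁰(B) = ℚ ⊗ End B` (`endAlgebra.exists_eq_algebraMap_mul_of`), so
`e^* = M⁻¹ · F^*`. [cite: Deligne1982HodgeCycles, §4 p. 30] -/
theorem exists_unop_bettiRep_eq_smul_pull (e : B.endAlgebra) :
    ∃ (c : ℚ) (F : B ⟶ B), MulOpposite.unop (bettiRep B e) = c • BettiUniverse.pull F.hom.hom.hom 1 := by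
  obtain ⟨M, F, -, hF⟩ := AbelianVariety.endAlgebra.exists_eq_algebraMap_mul_of e
  refine ⟨(M : ℚ)⁻¹, End.asHom F, ?_⟩
  rw [hF, map_mul, AlgHom.commutes, bettiRep_of, Algebra.algebraMap_eq_smul_one, smul_mul_assoc, one_mul,
    MulOpposite.unop_smul, MulOpposite.unop_op]

/-- **`End⁰(B)` acts on `H¹(B(ℂ); ℚ)` by Hodge endomorphisms**: `(e^* ⊗ ℂ)(Fᵖ) ⊆ Fᵖ` (pull-backs are
morphisms of Hodge structures, `BettiUniverse.pull_hodge`; Deligne §4: `End⁰(A)` acts on `H¹_B(A)` by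
endomorphisms of the Hodge structure). [cite: Deligne1982HodgeCycles, §4 p. 30] [cite: VoisinHodgeI2002, §7.3.2] -/
theorem unop_bettiRep_map_F_le (hHD : exists_isReal_hodgeModel) (hI : hodgePQ_independent_of_hodgeModel)
    (e : B.endAlgebra) (p : ℤ) :
    ((BettiUniverse.hodge hHD (AbelianVariety.isSmoothProjective_holds (A := B)) 1).F p).map
        ((MulOpposite.unop (bettiRep B e)).baseChange ℂ) ≤
      (BettiUniverse.hodge hHD (AbelianVariety.isSmoothProjective_holds (A := B)) 1).F p := by
  obtain ⟨c, F, hF⟩ := exists_unop_bettiRep_eq_smul_pull e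
  rw [hF, LinearMap.baseChange_smul, Submodule.map_le_iff_le_comap]
  intro x hx
  rw [Submodule.mem_comap, LinearMap.smul_apply]
  exact Submodule.smul_of_tower_mem _ c
    (BettiUniverse.pull_hodge hHD hI AbelianVariety.isSmoothProjective_holds
      AbelianVariety.isSmoothProjective_holds F.hom.hom.hom 1 p (Submodule.mem_map_of_mem hx))

/-- `e^* ∈ End_Hdg(H¹(B(ℂ); ℚ))` for every `e ∈ End⁰(B)`. [cite: Deligne1982HodgeCycles, §4 p. 30] -/
theorem unop_bettiRep_mem_endAlg (hHD : exists_isReal_hodgeModel) (hI : hodgePQ_independent_of_hodgeModel)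
    (e : B.endAlgebra) :
    MulOpposite.unop (bettiRep B e) ∈
      (BettiUniverse.hodge hHD (AbelianVariety.isSmoothProjective_holds (A := B)) 1).endAlg :=
  fun p => unop_bettiRep_map_F_le hHD hI e p

/-! ### §2 Riemann, field-free -/

/-- **Riemann's theorem for `End`, for every complex abelian variety**: a `ℚ`-linear endomorphism of
`H¹(B(ℂ); ℚ)` preserves the Hodge filtration iff it is `e^*` for some `e ∈ End⁰(B)` (`→`: fullness
`deligneMilne1982_Thm_6_20_full_holds` gives `u^* = k • a` with `u : B ⟶ B`, `k ≥ 1`, so `a = (k⁻¹ ⊗ u)^*`;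
`←`: §1). The field case is the tree's `mem_endAlg_hodge_one_iff`. [cite: DeligneMilne1982Tannakian, §6 Thm. 6.20] -/
theorem mem_endAlg_hodge_one_iff_exists_bettiRep (hHD : exists_isReal_hodgeModel)
    (hI : hodgePQ_independent_of_hodgeModel) (a : Module.End ℚ (bettiCohomology B.X 1)) :
    a ∈ (BettiUniverse.hodge hHD (AbelianVariety.isSmoothProjective_holds (A := B)) 1).endAlg ↔
      ∃ e : B.endAlgebra, MulOpposite.unop (bettiRep B e) = a := by
  constructor
  · intro ha
    obtain ⟨u, k, hk, hu⟩ := deligneMilne1982_Thm_6_20_full_holds B B a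
      ⟨BettiUniverse.realHodgeModel hHD (AbelianVariety.isSmoothProjective_holds (A := B))⟩
      (isHodgeMorphismOne_of_map_F_le hHD hI a ha)
    refine ⟨algebraMap ℚ B.endAlgebra ((k : ℚ)⁻¹) * AbelianVariety.endAlgebra.of B u, ?_⟩
    rw [map_mul, AlgHom.commutes, bettiRep_of, Algebra.algebraMap_eq_smul_one, smul_mul_assoc, one_mul,
      MulOpposite.unop_smul, MulOpposite.unop_op]
    refine LinearMap.ext fun x => ?_
    have hkx : (k : ℚ) • a x = bettiCohomology.map u.hom.hom.hom 1 x := by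
      rw [hu x, Nat.cast_smul_eq_nsmul]
    rw [LinearMap.smul_apply, ← hkx, smul_smul, inv_mul_cancel₀ (by exact_mod_cast hk.ne'), one_smul]
  · rintro ⟨e, rfl⟩
    exact unop_bettiRep_mem_endAlg hHD hI e

/-! ### §3 The identifications `End⁰(B)ᵐᵒᵖ ≃ End_Hdg(H¹)` and, for commutative `End⁰(B)`, `End⁰(B) ≃ End_Hdg(H¹)` -/

variable (B) in
/-- The rational representation un-opposed on the source: `End⁰(B)ᵐᵒᵖ →+* End_ℚ H¹(B(ℂ); ℚ)`,
`op e ↦ e^*` (a ring homomorphism because `(f g)^* = g^* f^*`). [cite: Lange2023AbelianVarietiesC, Prop. 1.1.8 and Cor. 2.4.26] -/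
def bettiRepOpRingHom : B.endAlgebraᵐᵒᵖ →+* Module.End ℚ (bettiCohomology B.X 1) where
  toFun x := MulOpposite.unop (bettiRep B (MulOpposite.unop x))
  map_one' := by rw [MulOpposite.unop_one, map_one, MulOpposite.unop_one]
  map_mul' x y := by rw [MulOpposite.unop_mul, map_mul, MulOpposite.unop_mul]
  map_zero' := by rw [MulOpposite.unop_zero, map_zero, MulOpposite.unop_zero]
  map_add' x y := by rw [MulOpposite.unop_add, map_add, MulOpposite.unop_add]

variable (B) in
/-- The same as a `ℚ`-algebra homomorphism. [cite: Lange2023AbelianVarietiesC, Prop. 1.1.8 and Cor. 2.4.26] -/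
def bettiRepOp : B.endAlgebraᵐᵒᵖ →ₐ[ℚ] Module.End ℚ (bettiCohomology B.X 1) := (bettiRepOpRingHom B).toRatAlgHom

/-- Unfolding: `bettiRepOp B x = (bettiRep B x.unop).unop` (the rational representation, un-opposed).
[cite: Lange2023AbelianVarietiesC, Prop. 1.1.8 and Cor. 2.4.26] -/
theorem bettiRepOp_apply (x : B.endAlgebraᵐᵒᵖ) :
    bettiRepOp B x = MulOpposite.unop (bettiRep B (MulOpposite.unop x)) := by
  rw [bettiRepOp, RingHom.toRatAlgHom_apply]
  rfl

/-- `bettiRepOp` is injective (faithfulness of the rational representation, `bettiRep_injective`).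
[cite: Lange2023AbelianVarietiesC, Prop. 1.1.8 and Cor. 2.4.26] -/
theorem bettiRepOp_injective : Function.Injective (bettiRepOp B) := by
  intro x y hxy
  rw [bettiRepOp_apply, bettiRepOp_apply] at hxy
  exact MulOpposite.unop_injective (bettiRep_injective (MulOpposite.unop_injective hxy))

/-- **`End⁰(B)ᵐᵒᵖ ≃ₐ[ℚ] End_Hdg(H¹(B(ℂ); ℚ))`** for every complex abelian variety `B` (Riemann: injective by
faithfulness, surjective by `mem_endAlg_hodge_one_iff_exists_bettiRep`). [cite: DeligneMilne1982Tannakian, §6 Thm. 6.20] -/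
def endAlgebraOpAlgEquivEndAlg (hHD : exists_isReal_hodgeModel) (hI : hodgePQ_independent_of_hodgeModel) :
    B.endAlgebraᵐᵒᵖ ≃ₐ[ℚ]
      (BettiUniverse.hodge hHD (AbelianVariety.isSmoothProjective_holds (A := B)) 1).endAlg :=
  AlgEquiv.ofBijective
    ((bettiRepOp B).codRestrict
      (BettiUniverse.hodge hHD (AbelianVariety.isSmoothProjective_holds (A := B)) 1).endAlg
      fun x => by
        rw [bettiRepOp_apply]
        exact unop_bettiRep_mem_endAlg hHD hI (MulOpposite.unop x))
    ⟨fun x y hxy => bettiRepOp_injective (congrArg Subtype.val hxy), fun a => by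
      obtain ⟨e, he⟩ := (mem_endAlg_hodge_one_iff_exists_bettiRep hHD hI
        (a : Module.End ℚ (bettiCohomology B.X 1))).1 a.2
      exact ⟨MulOpposite.op e, Subtype.ext (by rw [AlgHom.coe_codRestrict, bettiRepOp_apply,
        MulOpposite.unop_op, he])⟩⟩

/-- The identification is `op e ↦ e^*` on underlying maps. [cite: DeligneMilne1982Tannakian, §6 Thm. 6.20] -/
@[simp]
theorem coe_endAlgebraOpAlgEquivEndAlg_apply (hHD : exists_isReal_hodgeModel)
    (hI : hodgePQ_independent_of_hodgeModel) (x : B.endAlgebraᵐᵒᵖ) :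
    ((endAlgebraOpAlgEquivEndAlg hHD hI x :
        (BettiUniverse.hodge hHD (AbelianVariety.isSmoothProjective_holds (A := B)) 1).endAlg) :
      Module.End ℚ (bettiCohomology B.X 1)) = MulOpposite.unop (bettiRep B (MulOpposite.unop x)) := by
  rw [← bettiRepOp_apply]
  rfl

/-- **`dim_ℚ End_Hdg(H¹(B(ℂ); ℚ)) = dim_ℚ End⁰(B)`** (Riemann). [cite: DeligneMilne1982Tannakian, §6 Thm. 6.20] -/
theorem finrank_endAlg_hodge_one (hHD : exists_isReal_hodgeModel) (hI : hodgePQ_independent_of_hodgeModel) :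
    Module.finrank ℚ
        ↥(BettiUniverse.hodge hHD (AbelianVariety.isSmoothProjective_holds (A := B)) 1).endAlg =
      Module.finrank ℚ B.endAlgebra := by
  rw [← (endAlgebraOpAlgEquivEndAlg (B := B) hHD hI).toLinearEquiv.finrank_eq]
  exact (MulOpposite.opLinearEquiv ℚ (M := B.endAlgebra)).finrank_eq.symm

variable (B) in
/-- For COMMUTATIVE `End⁰(B)` the rational representation is itself a ring homomorphism
`End⁰(B) →+* End_ℚ H¹(B(ℂ); ℚ)`, `e ↦ e^*` (the field case is the tree's `hOneRingHom` with `φ = id`).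
[cite: Deligne1982HodgeCycles, §4 p. 30] -/
def bettiRepRingHomOfComm (hc : ∀ x y : B.endAlgebra, x * y = y * x) :
    B.endAlgebra →+* Module.End ℚ (bettiCohomology B.X 1) where
  toFun e := MulOpposite.unop (bettiRep B e)
  map_one' := by rw [map_one, MulOpposite.unop_one]
  map_mul' e e' := by rw [hc, map_mul, MulOpposite.unop_mul]
  map_zero' := by rw [map_zero, MulOpposite.unop_zero]
  map_add' e e' := by rw [map_add, MulOpposite.unop_add]

variable (B) in
/-- The same as a `ℚ`-algebra homomorphism. [cite: Deligne1982HodgeCycles, §4 p. 30] -/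
def bettiRepOfComm (hc : ∀ x y : B.endAlgebra, x * y = y * x) :
    B.endAlgebra →ₐ[ℚ] Module.End ℚ (bettiCohomology B.X 1) :=
  (bettiRepRingHomOfComm B hc).toRatAlgHom

/-- Unfolding: `bettiRepOfComm B hc e = (bettiRep B e).unop` (the rational representation).
[cite: Deligne1982HodgeCycles, §4 p. 30] -/
theorem bettiRepOfComm_apply (hc : ∀ x y : B.endAlgebra, x * y = y * x) (e : B.endAlgebra) :
    bettiRepOfComm B hc e = MulOpposite.unop (bettiRep B e) := by
  rw [bettiRepOfComm, RingHom.toRatAlgHom_apply]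
  rfl

/-- **`End⁰(B) ≃ₐ[ℚ] End_Hdg(H¹(B(ℂ); ℚ))` for commutative `End⁰(B)`** (e.g. `End⁰(A₁ × A₂) = E₁ × E₂` for
orthogonal real-multiplication varieties; the field case is `endFieldAlgEquivEndAlg`).
[cite: DeligneMilne1982Tannakian, §6 Thm. 6.20] -/
def endAlgebraAlgEquivEndAlgOfComm (hc : ∀ x y : B.endAlgebra, x * y = y * x)
    (hHD : exists_isReal_hodgeModel) (hI : hodgePQ_independent_of_hodgeModel) :
    B.endAlgebra ≃ₐ[ℚ] (BettiUniverse.hodge hHD (AbelianVariety.isSmoothProjective_holds (A := B)) 1).endAlg :=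
  AlgEquiv.ofBijective
    ((bettiRepOfComm B hc).codRestrict
      (BettiUniverse.hodge hHD (AbelianVariety.isSmoothProjective_holds (A := B)) 1).endAlg
      fun e => by
        rw [bettiRepOfComm_apply]
        exact unop_bettiRep_mem_endAlg hHD hI e)
    ⟨fun x y hxy => by
        have h := congrArg Subtype.val hxy
        rw [AlgHom.coe_codRestrict, AlgHom.coe_codRestrict, bettiRepOfComm_apply, bettiRepOfComm_apply] at h
        exact bettiRep_injective (MulOpposite.unop_injective h),
      fun a => by
        obtain ⟨e, he⟩ := (mem_endAlg_hodge_one_iff_exists_bettiRep hHD hI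
          (a : Module.End ℚ (bettiCohomology B.X 1))).1 a.2
        exact ⟨e, Subtype.ext (by rw [AlgHom.coe_codRestrict, bettiRepOfComm_apply, he])⟩⟩

/-- The identification is `e ↦ e^*` on underlying maps. [cite: DeligneMilne1982Tannakian, §6 Thm. 6.20] -/
@[simp]
theorem coe_endAlgebraAlgEquivEndAlgOfComm_apply (hc : ∀ x y : B.endAlgebra, x * y = y * x)
    (hHD : exists_isReal_hodgeModel) (hI : hodgePQ_independent_of_hodgeModel) (e : B.endAlgebra) :
    ((endAlgebraAlgEquivEndAlgOfComm hc hHD hI e :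
        (BettiUniverse.hodge hHD (AbelianVariety.isSmoothProjective_holds (A := B)) 1).endAlg) :
      Module.End ℚ (bettiCohomology B.X 1)) = MulOpposite.unop (bettiRep B e) := by
  rw [← bettiRepOfComm_apply hc]
  rfl

/-! ### §4 `Hom(A, B) = 0 ⟹ Hom_Hdg(H¹(B), H¹(A)) = 0` -/

/-- **Orthogonality passes to `H¹`**: if every homomorphism `A ⟶ B` is zero, every `ℚ`-linear map
`H¹(B(ℂ); ℚ) → H¹(A(ℂ); ℚ)` preserving the Hodge filtrations is zero (Riemann: such a map is `k⁻¹ u^*` for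
some `u : A ⟶ B`, `k ≥ 1`). For simple non-isogenous `A`, `B` this is «`Hom_Hdg(H¹(B), H¹(A)) = 0`», the
input of programme R3. [cite: DeligneMilne1982Tannakian, §6 Thm. 6.20] -/
theorem hodgeHom_one_eq_zero_of_forall_hom_eq_zero (hHD : exists_isReal_hodgeModel)
    (hI : hodgePQ_independent_of_hodgeModel) (hAB : ∀ u : A ⟶ B, u = 0)
    (ψ : bettiCohomology B.X 1 →ₗ[ℚ] bettiCohomology A.X 1)
    (hψ : ∀ p : ℤ,
      ((BettiUniverse.hodge hHD (AbelianVariety.isSmoothProjective_holds (A := B)) 1).F p).map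
          (ψ.baseChange ℂ) ≤
        (BettiUniverse.hodge hHD (AbelianVariety.isSmoothProjective_holds (A := A)) 1).F p) :
    ψ = 0 := by
  obtain ⟨u, k, hk, hu⟩ := deligneMilne1982_Thm_6_20_full_holds A B ψ
    ⟨BettiUniverse.realHodgeModel hHD (AbelianVariety.isSmoothProjective_holds (A := B))⟩
    (isHodgeMorphismOne_of_map_F_le hHD hI ψ hψ)
  refine LinearMap.ext fun x => ?_
  have hx := hu x
  rw [hAB u, bettiCohomology_map_zero_one] at hx
  have hk0 : (k : ℚ) ≠ 0 := by exact_mod_cast hk.ne'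
  have h2 : (k : ℚ) • ψ x = 0 := by
    rw [Nat.cast_smul_eq_nsmul, ← hx]
    rfl
  rw [LinearMap.zero_apply]
  exact (smul_eq_zero.1 h2).resolve_left hk0

end Riemann

end Literature.AlgebraicGeometry.HodgeTheory

end
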